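import Summits.MatrixMultiplication.OmegaCensus.ThreeSetPairZ4Z4Kit
import Mathlib.NumberTheory.LegendreSymbol.JacobiSymbol
import HarnessLib

/-!
# The three-set Pell congruence (gen-17 Conjecture B): `3x² − y² ≡ 7 (mod 8)` at a type-`Y` character

ω-census `pub-omega`, family (b3), seat pub-omega-group gen 18.  Framing: lottery ticket; floor = certified bounds/negative
ranges.  VALUE: the number-theoretic lemma behind the UNIFORM three-set theorem over `ℤ₄²`-quotients
(`ThreeSetUniformZ4Z4.lean`: no cube law `3|S||T||U| + 8 = 8|A|` in any dihedral-like group over ANY finite abelian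
`A ↠ ℤ₄ × ℤ₄`); NOT progress on ω.

**Lemma (`three_set_pell_congr`).**  Let `c = m + n i`, `a = a₁ + a₂ i` be Gaussian integers with `m + n` and `a₁ + a₂` odd, and
suppose `c̄ a b + c ā b + i·c a b̄ = −i^l` for some Gaussian integer `b` (the identity of a three-set shifted form at the
character `w'`, `three_set_pair_reduction`).  Write `c̄ a = x + y i`.  Then `x ≡ 0 (mod 4)` or `y ≡ 2 (mod 4)`; equivalently
`D := 3x² − y² ≡ 7 (mod 8)` (gen 17's CONJECTURE B, FAMILY-B-ADDENDUM-g17 §5b; it is a global fact, not a 2-adic one).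

*Proof.*  With `q = c a = q₁ + q₂ i` the identity reads `(2x − q₂) b₁ + q₁ b₂ = u₁`, `q₁ b₁ + (2x + q₂) b₂ = u₂` with
`(u₁, u₂) = ±(1, 0)` or `±(0, 1)`; its determinant is `4x² − |q|² = 3x² − y² = D`, so (Cramer) `D ∣ q₁` and `D ∣ q₂ + 2εx`
(`ε = ±1` the type of the unit).  Since `m q₁ + n q₂ = m x − n y`, this gives `D ∣ x m − n (y − 2εx)` and then, by the
polynomial identity `x²(m²+n²) − 2 n²(x − εy)² = (xm − n(y−2εx))(xm + n(y−2εx)) + n² D`, the congruence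
`|c|² x² ≡ 2 (n (x − εy))² (mod D)`.  Jacobi symbols (`jacobi_core`): `J(|c|² | |D|) = J(2 | |D|) = χ₈(|D|)`, while by
reciprocity (`|c|² ≡ 1 (mod 4)`) `J(|c|² | |D|) = J(|D| | |c|²) = J(∓4y² | |c|²) = 1` because `|c|²` divides
`x² + y² = |c|²|a|²`, i.e. `D ≡ −4y² (mod |c|²)`.  Hence `χ₈(|D|) = 1`, `D ≡ ±1 (mod 8)`, and `D = 3x² − y²` with `x + y` odd is
`≡ 3 (mod 4)`, so `D ≡ 7 (mod 8)`; the mod-`8` reading is gen 16's `pellPp_mod8`.  (The coprimalities `gcd(x, D) =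
gcd(|c|², D) = gcd(2y, |c|²) = 1` come from the unit: a common divisor of `x` and `D` divides `q`, hence the unit.)  ∎

`three_set_pell_congr_neg` is the same statement at the character `w' + 2w` (`c̄ a b − c ā b + i c a b̄ = −i^l`, obtained from
the first by `a ↦ i a`): `y ≡ 0 (mod 4)` or `x ≡ 2 (mod 4)`.
-/

namespace Summit.MatrixMultiplication.OmegaCensus

open NumberTheorySymbols

/-! ## The Jacobi-symbol core -/

/-- **Jacobi core.**  `D` odd, `K > 0`, `K ≡ 1 (mod 4)`, `gcd(K, D) = gcd(U, D) = gcd(2y, K) = 1`, `D ∣ K U² − 2 V²` and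
`K ∣ D + 4y²` force `D ≡ ±1 (mod 8)`: `χ₈(|D|) = J(2 | |D|) = J(K | |D|) = J(|D| | K) = J(∓(2y)² | K) = 1`. [folklore] -/
theorem jacobi_core {D K U V y : ℤ} (hD : Odd D) (hK0 : 0 < K) (hK4 : K % 4 = 1)
    (hKD : Int.gcd K D = 1) (hUD : Int.gcd U D = 1) (hyK : Int.gcd (2 * y) K = 1)
    (hdiv : D ∣ K * U ^ 2 - 2 * V ^ 2) (hKy : K ∣ D + 4 * y ^ 2) : D % 8 = 1 ∨ D % 8 = 7 := by
  set b : ℕ := D.natAbs with hb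
  have hbodd : Odd b := Int.natAbs_odd.2 hD
  obtain ⟨k, hk⟩ : ∃ k : ℕ, (k : ℤ) = K := ⟨K.toNat, Int.toNat_of_nonneg hK0.le⟩
  have hk4 : k % 4 = 1 := by omega
  have hkodd : Odd k := Nat.odd_iff.2 (by omega)
  -- gcd transfers
  have hgcd : ∀ a : ℤ, Int.gcd a (b : ℤ) = Int.gcd a D := fun a => by simp [hb, Int.gcd, Int.natAbs_abs]
  have hKb : K.gcd (b : ℤ) = 1 := by rw [hgcd]; exact hKD
  have hUb : U.gcd (b : ℤ) = 1 := by rw [hgcd]; exact hUD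
  have hyk : (2 * y).gcd (k : ℤ) = 1 := by rw [hk]; exact hyK
  -- (1) `J(K U² | b) = J(2 V² | b)`
  have h1 : J(K * U ^ 2 | b) = J(2 * V ^ 2 | b) := by
    apply jacobiSym.mod_left'
    have hbD : (b : ℤ) ∣ K * U ^ 2 - 2 * V ^ 2 := Int.natAbs_dvd.2 hdiv
    have hm : K * U ^ 2 ≡ 2 * V ^ 2 [ZMOD (b : ℤ)] :=
      Int.modEq_iff_dvd.2 (by rw [← neg_sub]; exact (dvd_neg).2 hbD)
    exact hm
  -- (2) the two sides
  have h2 : J(K * U ^ 2 | b) = J(K | b) := by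
    rw [jacobiSym.mul_left, jacobiSym.sq_one' hUb, mul_one]
  have h3 : J(2 * V ^ 2 | b) = J(2 | b) * J(V | b) ^ 2 := by
    rw [jacobiSym.mul_left, jacobiSym.pow_left]
  have hKne : J(K | b) ≠ 0 := jacobiSym.ne_zero hKb
  have hV : J(V | b) ^ 2 = 1 := by
    rcases jacobiSym.trichotomy V b with h0 | h0 | h0
    · exfalso; apply hKne; rw [← h2, h1, h3, h0]; ring
    · rw [h0]; ring
    · rw [h0]; ring
  have h4 : J(K | b) = ZMod.χ₈ b := by
    rw [← h2, h1, h3, hV, mul_one, jacobiSym.at_two hbodd]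
  -- (3) reciprocity
  have h5 : J(K | b) = J((b : ℤ) | k) := by
    rw [← hk]; exact jacobiSym.quadratic_reciprocity_one_mod_four hk4 hbodd
  -- (4) `J(b | k) = 1`
  have hsq : J((2 * y) ^ 2 | k) = 1 := jacobiSym.sq_one' hyk
  have h6 : J((b : ℤ) | k) = 1 := by
    rcases Int.natAbs_eq D with hDb | hDb
    · have hmod : (b : ℤ) % (k : ℤ) = (-1 * (2 * y) ^ 2) % (k : ℤ) := by
        have hm : (b : ℤ) ≡ -1 * (2 * y) ^ 2 [ZMOD (k : ℤ)] := Int.modEq_iff_dvd.2 (by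
          rw [hk]
          have e : -1 * (2 * y) ^ 2 - (b : ℤ) = -(D + 4 * y ^ 2) := by rw [hDb]; ring
          rw [e]; exact (dvd_neg).2 hKy)
        exact hm
      rw [jacobiSym.mod_left' hmod, jacobiSym.mul_left, hsq, mul_one, jacobiSym.at_neg_one hkodd,
        ZMod.χ₄_nat_one_mod_four hk4]
    · have hmod : (b : ℤ) % (k : ℤ) = ((2 * y) ^ 2) % (k : ℤ) := by
        have hbD : (b : ℤ) = -D := by omega
        have hm : (b : ℤ) ≡ (2 * y) ^ 2 [ZMOD (k : ℤ)] := Int.modEq_iff_dvd.2 (by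
          rw [hk]
          have e : (2 * y) ^ 2 - (b : ℤ) = D + 4 * y ^ 2 := by rw [hbD]; ring
          rw [e]; exact hKy)
        exact hm
      rw [jacobiSym.mod_left' hmod, hsq]
  -- (5) `χ₈ b = 1`
  have h7 : b % 8 = 1 ∨ b % 8 = 7 := by
    have hχ : ZMod.χ₈ b = 1 := by rw [← h4, h5, h6]
    rw [ZMod.χ₈_nat_eq_if_mod_eight] at hχ
    split_ifs at hχ <;> omega
  rcases Int.natAbs_eq D with hDb | hDb <;> omega

/-! ## Arithmetic helpers -/

/-- `m + n` odd ⇒ `m² + n² ≡ 1 (mod 4)`. [folklore] -/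
theorem sq_add_sq_mod_four {m n : ℤ} (h : Odd (m + n)) : (m ^ 2 + n ^ 2) % 4 = 1 := by
  obtain ⟨t, ht⟩ := h
  obtain ⟨e, he⟩ := Int.even_mul_succ_self m
  have hn : n = 2 * t + 1 - m := by linarith
  have key : m ^ 2 + n ^ 2 - 1 = 4 * (e - m - m * t + t ^ 2 + t) := by
    rw [hn]; linear_combination (2 : ℤ) * he
  omega

/-- `m + n` odd ⇒ `m² + n² > 0`. [folklore] -/
theorem sq_add_sq_pos {m n : ℤ} (h : Odd (m + n)) : 0 < m ^ 2 + n ^ 2 := by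
  have := sq_add_sq_mod_four h
  have h0 : 0 ≤ m ^ 2 + n ^ 2 := by positivity
  omega

/-- If `g ∣ 4` and `g ∣ K` with `K ≡ 1 (mod 4)` then `g ∣ 1`. [folklore] -/
theorem dvd_one_of_dvd_four {g K : ℤ} (hK4 : K % 4 = 1) (h4 : g ∣ 4) (hK : g ∣ K) : g ∣ 1 := by
  have e : K - 4 * (K / 4) = 1 := by omega
  rw [← e]
  exact dvd_sub hK (dvd_mul_of_dvd_left h4 _)

/-- `gcd = 1` from `↑gcd ∣ 1`. [folklore] -/
theorem int_gcd_eq_one_of_dvd_one {a b : ℤ} (h : ((Int.gcd a b : ℕ) : ℤ) ∣ 1) : Int.gcd a b = 1 := by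
  have := Int.eq_one_of_dvd_one (Int.natCast_nonneg _) h
  exact_mod_cast this

/-- `i^(l+1) = i^l · i` for exponents read in `ZMod 4`. [folklore] -/
theorem ipow_succ (l : ZMod 4) :
    (⟨0, 1⟩ : GaussianInt) ^ (l + 1).val = (⟨0, 1⟩ : GaussianInt) ^ l.val * ⟨0, 1⟩ := by
  revert l; decide

/-! ## The integer core of the Pell congruence -/

/-- **Integer core.**  With `x = m a₁ + n a₂`, `y = m a₂ − n a₁`, `q₁ = m a₁ − n a₂`, `q₂ = m a₂ + n a₁` (`c̄a = x + yi`,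
`ca = q₁ + q₂ i`): the two real equations of `c̄ab + cāb + i cab̄ = u`, `u ∈ {±1, ±i}`, force `x ≡ 0 (mod 4)` or
`y ≡ 2 (mod 4)`. [folklore] -/
theorem pell_congr_int {m n a₁ a₂ b₁ b₂ u₁ u₂ : ℤ} (hc : Odd (m + n)) (ha : Odd (a₁ + a₂))
    (hu : ((u₁ = 1 ∨ u₁ = -1) ∧ u₂ = 0) ∨ (u₁ = 0 ∧ (u₂ = 1 ∨ u₂ = -1)))
    (hre : (2 * (m * a₁ + n * a₂) - (m * a₂ + n * a₁)) * b₁ + (m * a₁ - n * a₂) * b₂ = u₁)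
    (him : (m * a₁ - n * a₂) * b₁ + (2 * (m * a₁ + n * a₂) + (m * a₂ + n * a₁)) * b₂ = u₂) :
    (m * a₁ + n * a₂) % 4 = 0 ∨ (m * a₂ - n * a₁) % 4 = 2 := by
  set x := m * a₁ + n * a₂ with hx
  set y := m * a₂ - n * a₁ with hy
  set q₁ := m * a₁ - n * a₂ with hq₁
  set q₂ := m * a₂ + n * a₁ with hq₂
  set K := m ^ 2 + n ^ 2 with hK
  obtain ⟨D, hD⟩ : ∃ D : ℤ, D = 3 * x ^ 2 - y ^ 2 := ⟨_, rfl⟩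
  -- norms: `q₁² + q₂² = x² + y² = K (a₁² + a₂²)`
  have hnorm : q₁ ^ 2 + q₂ ^ 2 = x ^ 2 + y ^ 2 := by rw [hx, hy, hq₁, hq₂]; ring
  have hKL : x ^ 2 + y ^ 2 = K * (a₁ ^ 2 + a₂ ^ 2) := by rw [hx, hy, hK]; ring
  have hDq : D = (2 * x - q₂) * (2 * x + q₂) - q₁ ^ 2 := by rw [hD]; nlinarith [hnorm]
  -- Cramer
  have hb₁ : D * b₁ = (2 * x + q₂) * u₁ - q₁ * u₂ := by
    rw [hDq]; linear_combination (2 * x + q₂) * hre - q₁ * him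
  have hb₂ : D * b₂ = (2 * x - q₂) * u₂ - q₁ * u₁ := by
    rw [hDq]; linear_combination (2 * x - q₂) * him - q₁ * hre
  -- parities
  have hxy : Odd (x + y) := by
    have e : x + y = (m + n) * (a₁ + a₂) - 2 * (n * a₁) := by rw [hx, hy]; ring
    rw [e]; exact (hc.mul ha).sub_even (even_two_mul _)
  have hDodd : Odd D := by
    obtain ⟨k, hk⟩ := hxy
    have hxk : x = 2 * k + 1 - y := by linarith
    obtain ⟨e, he⟩ := Int.even_mul_succ_self y
    refine ⟨6 * k ^ 2 + 6 * k + 1 - 6 * k * y + 2 * e - 4 * y, ?_⟩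
    rw [hD, hxk]; linear_combination (2 : ℤ) * he
  have hK4 : K % 4 = 1 := sq_add_sq_mod_four hc
  have hK0 : 0 < K := sq_add_sq_pos hc
  -- the divisibilities `D ∣ q₁`, `D ∣ q₂ + 2εx`, and the unit argument `g ∣ x → g ∣ D → g ∣ 1`
  have main : ∃ ε : ℤ, (ε = 1 ∨ ε = -1) ∧ D ∣ q₁ ∧ D ∣ q₂ - 2 * ε * x ∧
      ∀ g : ℤ, g ∣ x → g ∣ D → g ∣ 1 := by
    rcases hu with ⟨hu₁, rfl⟩ | ⟨rfl, hu₂⟩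
    · -- `u = ±1`: `D b₁ = ±(2x + q₂)`, `D b₂ = ∓ q₁`, `ε = −1`
      refine ⟨-1, Or.inr rfl, ?_, ?_, fun g hgx hgD => ?_⟩
      · rcases hu₁ with rfl | rfl
        · exact (dvd_neg).1 ⟨b₂, by linear_combination -hb₂⟩
        · exact ⟨b₂, by linear_combination -hb₂⟩
      · rcases hu₁ with rfl | rfl
        · exact ⟨b₁, by linear_combination -hb₁⟩
        · exact (dvd_neg).1 ⟨b₁, by linear_combination -hb₁⟩
      · -- `g ∣ x`, `g ∣ D ∣ q₁`, `g ∣ q₂` ⇒ `g ∣ u₁ = ±1`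
        have hq₁g : g ∣ q₁ := by
          rcases hu₁ with rfl | rfl
          · exact hgD.trans ((dvd_neg).1 ⟨b₂, by linear_combination -hb₂⟩)
          · exact hgD.trans ⟨b₂, by linear_combination -hb₂⟩
        have hq₂g : g ∣ q₂ := by
          have h2 : g ∣ q₂ - 2 * (-1) * x := by
            rcases hu₁ with rfl | rfl
            · exact hgD.trans ⟨b₁, by linear_combination -hb₁⟩
            · exact hgD.trans ((dvd_neg).1 ⟨b₁, by linear_combination -hb₁⟩)
          have h3 : q₂ = (q₂ - 2 * (-1) * x) - 2 * x := by ring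
          rw [h3]; exact dvd_sub h2 (dvd_mul_of_dvd_right hgx _)
        have hu₁g : g ∣ u₁ := by
          rw [← hre]
          exact dvd_add (dvd_mul_of_dvd_left (dvd_sub (dvd_mul_of_dvd_right hgx _) hq₂g) _)
            (dvd_mul_of_dvd_left hq₁g _)
        rcases hu₁ with rfl | rfl
        · exact hu₁g
        · exact (dvd_neg).1 hu₁g
    · -- `u = ±i`: `D b₁ = ∓ q₁`, `D b₂ = ±(2x − q₂)`, `ε = 1`
      refine ⟨1, Or.inl rfl, ?_, ?_, fun g hgx hgD => ?_⟩
      · rcases hu₂ with rfl | rfl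
        · exact (dvd_neg).1 ⟨b₁, by linear_combination -hb₁⟩
        · exact ⟨b₁, by linear_combination -hb₁⟩
      · rcases hu₂ with rfl | rfl
        · exact (dvd_neg).1 ⟨b₂, by linear_combination -hb₂⟩
        · exact ⟨b₂, by linear_combination -hb₂⟩
      · have hq₁g : g ∣ q₁ := by
          rcases hu₂ with rfl | rfl
          · exact hgD.trans ((dvd_neg).1 ⟨b₁, by linear_combination -hb₁⟩)
          · exact hgD.trans ⟨b₁, by linear_combination -hb₁⟩
        have hq₂g : g ∣ q₂ := by
          have h2 : g ∣ q₂ - 2 * 1 * x := by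
            rcases hu₂ with rfl | rfl
            · exact hgD.trans ((dvd_neg).1 ⟨b₂, by linear_combination -hb₂⟩)
            · exact hgD.trans ⟨b₂, by linear_combination -hb₂⟩
          have h3 : q₂ = (q₂ - 2 * 1 * x) + 2 * x := by ring
          rw [h3]; exact dvd_add h2 (dvd_mul_of_dvd_right hgx _)
        have hu₂g : g ∣ u₂ := by
          rw [← him]
          exact dvd_add (dvd_mul_of_dvd_left hq₁g _)
            (dvd_mul_of_dvd_left (dvd_add (dvd_mul_of_dvd_right hgx _) hq₂g) _)
        rcases hu₂ with rfl | rfl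
        · exact hu₂g
        · exact (dvd_neg).1 hu₂g
  obtain ⟨ε, hε, hDq₁, hDq₂, hunit⟩ := main
  have hε2 : ε ^ 2 = 1 := by rcases hε with rfl | rfl <;> norm_num
  -- (K): `D ∣ x m − n (y + 2εx)` and the square congruence
  have hKc : D ∣ x * m - n * (y + 2 * ε * x) := by
    have e : x * m - n * (y + 2 * ε * x) = m * q₁ + n * (q₂ - 2 * ε * x) := by rw [hx, hy, hq₁, hq₂]; ring
    rw [e]; exact dvd_add (dvd_mul_of_dvd_right hDq₁ _) (dvd_mul_of_dvd_right hDq₂ _)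
  have hdiv : D ∣ K * x ^ 2 - 2 * (n * (x + ε * y)) ^ 2 := by
    have e : K * x ^ 2 - 2 * (n * (x + ε * y)) ^ 2 =
        (x * m - n * (y + 2 * ε * x)) * (x * m + n * (y + 2 * ε * x)) + n ^ 2 * D := by
      rw [hD, hK]; linear_combination (4 * n ^ 2 * x ^ 2 - 2 * n ^ 2 * y ^ 2) * hε2
    rw [e]; exact dvd_add (dvd_mul_of_dvd_left hKc _) (dvd_mul_left _ _)
  -- coprimalities
  have hcop : IsCoprime x y := by
    rw [Int.isCoprime_iff_gcd_eq_one]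
    apply int_gcd_eq_one_of_dvd_one
    refine hunit _ (Int.gcd_dvd_left _ _) ?_
    rw [hD]
    exact dvd_sub (dvd_mul_of_dvd_right (dvd_pow (Int.gcd_dvd_left _ _) two_ne_zero) _)
      (dvd_pow (Int.gcd_dvd_right _ _) two_ne_zero)
  obtain ⟨α, β, hαβ⟩ := (hcop.pow (m := 2) (n := 2))
  have hUD : Int.gcd x D = 1 := int_gcd_eq_one_of_dvd_one (hunit _ (Int.gcd_dvd_left _ _) (Int.gcd_dvd_right _ _))
  have hKD : Int.gcd K D = 1 := by
    apply int_gcd_eq_one_of_dvd_one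
    set g : ℤ := ((Int.gcd K D : ℕ) : ℤ)
    have hgK : g ∣ K := Int.gcd_dvd_left _ _
    have hgD : g ∣ D := Int.gcd_dvd_right _ _
    have hg2 : g ∣ x ^ 2 + y ^ 2 := by rw [hKL]; exact dvd_mul_of_dvd_left hgK _
    have hgx : g ∣ 4 * x ^ 2 := by
      have e : 4 * x ^ 2 = (x ^ 2 + y ^ 2) + D := by rw [hD]; ring
      rw [e]; exact dvd_add hg2 hgD
    have hgy : g ∣ 4 * y ^ 2 := by
      have e : 4 * y ^ 2 = 3 * (x ^ 2 + y ^ 2) - D := by rw [hD]; ring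
      rw [e]; exact dvd_sub (dvd_mul_of_dvd_right hg2 _) hgD
    have hg4 : g ∣ 4 := by
      have e : (4 : ℤ) = α * (4 * x ^ 2) + β * (4 * y ^ 2) := by linear_combination -(4 : ℤ) * hαβ
      rw [e]; exact dvd_add (dvd_mul_of_dvd_right hgx _) (dvd_mul_of_dvd_right hgy _)
    exact dvd_one_of_dvd_four hK4 hg4 hgK
  have hyK : Int.gcd (2 * y) K = 1 := by
    apply int_gcd_eq_one_of_dvd_one
    set g : ℤ := ((Int.gcd (2 * y) K : ℕ) : ℤ)
    have hgy : g ∣ 2 * y := Int.gcd_dvd_left _ _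
    have hgK : g ∣ K := Int.gcd_dvd_right _ _
    have hg2 : g ∣ x ^ 2 + y ^ 2 := by rw [hKL]; exact dvd_mul_of_dvd_left hgK _
    have hgy2 : g ∣ 4 * y ^ 2 := by
      have e : 4 * y ^ 2 = (2 * y) * (2 * y) := by ring
      rw [e]; exact dvd_mul_of_dvd_left hgy _
    have hgx : g ∣ 4 * x ^ 2 := by
      have e : 4 * x ^ 2 = 4 * (x ^ 2 + y ^ 2) - 4 * y ^ 2 := by ring
      rw [e]; exact dvd_sub (dvd_mul_of_dvd_right hg2 _) hgy2
    have hg4 : g ∣ 4 := by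
      have e : (4 : ℤ) = α * (4 * x ^ 2) + β * (4 * y ^ 2) := by linear_combination -(4 : ℤ) * hαβ
      rw [e]; exact dvd_add (dvd_mul_of_dvd_right hgx _) (dvd_mul_of_dvd_right hgy2 _)
    exact dvd_one_of_dvd_four hK4 hg4 hgK
  have hKy : K ∣ D + 4 * y ^ 2 := ⟨3 * (a₁ ^ 2 + a₂ ^ 2), by rw [hD]; linear_combination (3 : ℤ) * hKL⟩
  -- Jacobi ⇒ `D ≡ ±1 (mod 8)`
  have hD8 := jacobi_core hDodd hK0 hK4 hKD hUD hyK hdiv hKy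
  -- mod `8` reading (`pellPp_mod8`)
  obtain ⟨k, hk⟩ := hxy
  have hsum : (x : ZMod 8) + (y : ZMod 8) = 2 * (k : ZMod 8) + 1 := by exact_mod_cast congrArg (Int.cast : ℤ → ZMod 8) hk
  have hPell : 3 * (x : ZMod 8) * (x : ZMod 8) - (y : ZMod 8) * (y : ZMod 8) = 1 ∨
      3 * (x : ZMod 8) * (x : ZMod 8) - (y : ZMod 8) * (y : ZMod 8) = -1 := by
    have hcast : ((D : ℤ) : ZMod 8) = 3 * (x : ZMod 8) * (x : ZMod 8) - (y : ZMod 8) * (y : ZMod 8) := by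
      rw [hD]; push_cast; ring
    rw [← hcast]
    rcases hD8 with h8 | h8
    · left
      obtain ⟨t, ht⟩ : ∃ t, D = 8 * t + 1 := ⟨D / 8, by omega⟩
      rw [ht]; push_cast; generalize (t : ZMod 8) = T; revert T; decide
    · right
      obtain ⟨t, ht⟩ : ∃ t, D = 8 * t + 7 := ⟨D / 8, by omega⟩
      rw [ht]; push_cast; generalize (t : ZMod 8) = T; revert T; decide
  rcases pellPp_mod8 _ _ _ hsum hPell with (h0 | h4) | (h0 | h4)
  · left; have := emod_of_zmod8 (c := 0) (by norm_num) (by norm_num) (by exact_mod_cast h0); omega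
  · left; have := emod_of_zmod8 (c := 4) (by norm_num) (by norm_num) (by exact_mod_cast h4); omega
  · right; have := emod_of_zmod8 (c := 2) (by norm_num) (by norm_num) (by exact_mod_cast h0); omega
  · right; have := emod_of_zmod8 (c := 6) (by norm_num) (by norm_num) (by exact_mod_cast h4); omega

/-! ## The Gaussian-integer statements used by the reduction -/

/-- **Three-set Pell congruence at `w'` (gen-17 Conjecture B).**  If `c̄ a b + c ā b + i c a b̄ = −i^l` with `c = m + n i`,
`a = a₁ + a₂ i`, `m + n` and `a₁ + a₂` odd, then for `c̄ a = x + y i`: `x ≡ 0 (mod 4)` or `y ≡ 2 (mod 4)`. [folklore] -/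
theorem three_set_pell_congr {m n a₁ a₂ : ℤ} {b : GaussianInt} {l : ZMod 4} (hc : Odd (m + n)) (ha : Odd (a₁ + a₂))
    (h : star (⟨m, n⟩ : GaussianInt) * ⟨a₁, a₂⟩ * b + 1 * ⟨m, n⟩ * star (⟨a₁, a₂⟩ : GaussianInt) * b +
      (⟨0, 1⟩ : GaussianInt) * ⟨m, n⟩ * ⟨a₁, a₂⟩ * star b = -(⟨0, 1⟩ : GaussianInt) ^ l.val) :
    (m * a₁ + n * a₂) % 4 = 0 ∨ (m * a₂ - n * a₁) % 4 = 2 := by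
  obtain ⟨b₁, b₂⟩ := b
  rcases ipow_cases l with hl | hl | hl | hl <;> rw [hl] at h <;> rw [Zsqrtd.ext_iff] at h <;>
    obtain ⟨hre, him⟩ := h <;> simp at hre him
  · exact pell_congr_int (m := m) (n := n) (a₁ := a₁) (a₂ := a₂) (b₁ := b₁) (b₂ := b₂) (u₁ := -1) (u₂ := 0) hc ha
      (by norm_num) (by linear_combination hre) (by linear_combination him)
  · exact pell_congr_int (m := m) (n := n) (a₁ := a₁) (a₂ := a₂) (b₁ := b₁) (b₂ := b₂) (u₁ := 0) (u₂ := -1) hc ha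
      (by norm_num) (by linear_combination hre) (by linear_combination him)
  · exact pell_congr_int (m := m) (n := n) (a₁ := a₁) (a₂ := a₂) (b₁ := b₁) (b₂ := b₂) (u₁ := 1) (u₂ := 0) hc ha
      (by norm_num) (by linear_combination hre) (by linear_combination him)
  · exact pell_congr_int (m := m) (n := n) (a₁ := a₁) (a₂ := a₂) (b₁ := b₁) (b₂ := b₂) (u₁ := 0) (u₂ := 1) hc ha
      (by norm_num) (by linear_combination hre) (by linear_combination him)

/-- **Three-set Pell congruence at `w' + 2w`.**  If `c̄ a b − c ā b + i c a b̄ = −i^l` (same parity hypotheses), then for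
`c̄ a = x + y i`: `y ≡ 0 (mod 4)` or `x ≡ 2 (mod 4)` — the previous statement for `a ↦ i a`. [folklore] -/
theorem three_set_pell_congr_neg {m n a₁ a₂ : ℤ} {b : GaussianInt} {l : ZMod 4} (hc : Odd (m + n)) (ha : Odd (a₁ + a₂))
    (h : star (⟨m, n⟩ : GaussianInt) * ⟨a₁, a₂⟩ * b + (-1) * ⟨m, n⟩ * star (⟨a₁, a₂⟩ : GaussianInt) * b +
      (⟨0, 1⟩ : GaussianInt) * ⟨m, n⟩ * ⟨a₁, a₂⟩ * star b = -(⟨0, 1⟩ : GaussianInt) ^ l.val) :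
    (m * a₂ - n * a₁) % 4 = 0 ∨ (m * a₁ + n * a₂) % 4 = 2 := by
  have ha' : Odd (-a₂ + a₁) := by obtain ⟨k, hk⟩ := ha; exact ⟨k - a₂, by linarith⟩
  have h' : star (⟨m, n⟩ : GaussianInt) * ⟨-a₂, a₁⟩ * b + 1 * ⟨m, n⟩ * star (⟨-a₂, a₁⟩ : GaussianInt) * b +
      (⟨0, 1⟩ : GaussianInt) * ⟨m, n⟩ * ⟨-a₂, a₁⟩ * star b = -(⟨0, 1⟩ : GaussianInt) ^ (l + 1).val := by
    rw [ipow_succ]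
    obtain ⟨b₁, b₂⟩ := b
    rw [Zsqrtd.ext_iff] at h ⊢
    obtain ⟨hre, him⟩ := h
    simp at hre him ⊢
    constructor
    · linear_combination -him
    · linear_combination hre
  have := three_set_pell_congr hc ha' h'
  simp only [mul_neg, sub_neg_eq_add] at this
  omega

end Summit.MatrixMultiplication.OmegaCensus
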